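/-
Copyright: literature formalisation (no new mathematics).  Bałaban, *Propagators and renormalization transformations for
lattice gauge theories. II*, Commun. Math. Phys. 96 (1984) 223–250 — Propositions 2.3 (2.86)–(2.87) and 2.7 (2.149) on
the (k+1)-level geometry with its cube cover, in their census typing, with thresholds and constants uniform in k.
-/
import Mathlib
import Literature.MathematicalPhysics.QuantumFieldTheory.Balaban1983to89.B6TowerCover

/-!
# [B6] Propositions 2.3 (2.87) and 2.7 (2.149) IN THEIR PRINTED (CENSUS) TYPING on the (k+1)-LEVEL TOWER FAMILY —
# `B6.Prop23Printed` ∕ `B6.Prop27Printed` with witnesses (M₁, δ, O(1)) UNIFORM IN THE NUMBER OF LEVELS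

CITATION HEADER (unit b2b-balaban-b06-g23, gen 23 of the B06 lineage; the imported modules are not modified).  Source:
T. Bałaban, *Propagators and renormalization transformations for lattice gauge theories. II*, Commun. Math. Phys. **96**
(1984) 223–250 [Balaban1984PropagatorsII] (= [B6]).  Renders read AS IMAGES this generation: p. 238 (Proposition 2.3,
(2.85)–(2.87)), p. 248 ((2.142)–(2.147)) and p. 249 ((2.148)–(2.149), Proposition 2.7); pp. 229–230, 235 (the cover 𝒟,
(2.36), the cubes □, □̃) as certified in the headers of `B6TowerCover` ∕ `B6CoverTwoLevel` (same lineage).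

THE PRINTED TEXT (verbatim).  p. 238: *"so for M large enough the norm is small. … An estimate of the terms with the
commutator is even simpler and gives a factor O(M⁻¹). … |R(y, y′)| ≤ O(M⁻¹)e^{−δ₁d(y,y′)}(L^{j′}η)^{−d}, y, y′ ∈ 𝔅,
y′ ∈ Λ_{j′}, (2.85) and by Lemma 2.1 we get* **Proposition 2.3.** *An inverse of the operator Q′G′²Q′\* is given by the
convergent expansion (Q′G′²Q′\*)^{−1} = C(I − R)^{−1} = Σ_{n=0}^{∞} CRⁿ = Σ_ω h_{□₀}C_{□₀}h_{□₀}R_{□₁,□₂}C_{□₂}h_{□₂}·…·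
R_{□_{2n−1},□_{2n}}C_{□_{2n}}h_{□_{2n}}, (2.86) and it satisfies the estimate |(Q′G′²Q′\*)^{−1}(y, y′)| ≤
O(1)(L^jη)^{−4}(L^{j′}η)^{−d}e^{−½δ₁d(y,y′)} y, y′ ∈ 𝔅, y ∈ Λ_j, y′ ∈ Λ_{j′}. (2.87)"*.  p. 248: *"Finally let us
consider the operator QGQ\* and its inverse. We consider these operators on the L²-space defined by (2.69) with sites
replaced by bonds. … From (2.136) we have |(QGQ\*)(b, b′)| ≤ O(1)(L^jη)²(L^{j′}η)^{−d}e^{−δ₃d(b,b′)}, b ∈ Λ_j, b′ ∈ Λ_{j′}.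
(2.142) Keeping the same notations as before we consider the operators C_□ = ((QG_□Q\*)↾_□)^{−1}, C = Σ_{□∈𝒟} h_□C_□h_□.
(2.143)"*.  p. 249: *"|C_□(b, b′)| ≤ O(1)(L^jη)^{−d−2}e^{−δ₄(L^jη)^{−1}|b₋−b′₋|}, b, b′ ∈ 𝔅 ∩ □. (2.148) We form the
equality for QGQ\*C in exactly the same way as in (2.82) replacing only in the definition of R_{□,□′} the operators Q′,
G′(□̃)², G′² by Q, G_□, G. We have the same estimates now as before, but with powers of scaling factors changed properly
(we replace +4 and −4 in (2.83) by +2 and −2), thus we have (2.85) and this implies* **Proposition 2.7.** *The operator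
(QGQ\*)^{−1} is given by the convergent expansions of the form (2.86), and it satisfies the bound |(QGQ\*)^{−1}(b, b′)| ≤
O(1)(L^jη)^{−2}(L^{j′}η)^{−d}e^{−½δ₄d(b,b′)}, b ∈ Λ_j, b′ ∈ Λ_{j′}. (2.149)"*.

THE POINT.  The census declarations `B6.Prop23Printed` ∕ `B6.Prop27Printed` (the verbatim typing of (2.87) ∕ (2.149):
*there are M₁, δ, O(1) such that for every situation of a family with M ≥ M₁ …*) had so far been INSTANTIATED only on
one- and two-point consistency models (`B6Prop23TwoLevel.prop23Printed_twoLevel`, `B6Prop27TwoLevel.prop27Printed_twoLevel_tl`: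
one cube, L = 1).  Generations 20–22 of this lineage built the coordinatised (k+1)-level geometry `B6LevelTower.twGeo`
(k + 1 levels of boxes of (nM + 1)^d sites, scale ratio L, the level separation (2.2) with content), the k-UNIFORM
(2.61)∕(2.63) constants K_TW of `B6TowerSums`, and the cube cover 𝒟 = ⋃_{l=0}^{k} 𝒟_l with its partition of unity (2.36)
of `B6TowerCover`, discharging every geometry- and cover-side binder of the Proposition 2.3 engine.  This leaf closes the
loop to the census typing ON THAT GEOMETRY: (§1) the power-p engine `B6Prop27TwoLevel.inverse_assembled_pow_twoLevel`
(p = 2: Proposition 2.7 (2.143) ⟹ (2.85) ⟹ (2.86) ⟹ (2.149); p = 4: Proposition 2.3 (2.82) ⟹ (2.85) ⟹ (2.86) ⟹ (2.87),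
same threshold by `K285TLP_four`) on `twGeo d k (nM) M L η R` with the tower cover, EVERY geometry ∕ cover binder
discharged, for every k and every p; (§2) the threshold constant Kᵀᴸ_p of *"for M large enough"* read on a tower depends
on the geometry through L only — it is the SAME number K_p^tow(d, L, rates) for every number of levels k + 1, every box
side, every M, η, R (`K285TLP_twGeo`, `KtowerP`); (§3) hence `B6.Prop27Printed` ∕ `B6.Prop23Printed` hold on EVERY FAMILY
of tower situations i ↦ `twGeo d (k_i) (n_iM_i) M_i L η_i R_i` (d, L and the rates fixed; k_i, n_i, M_i, η_i, R_i and
the kernels free) whose analytic data satisfy the printed inputs ((2.142) ∕ the (2.66)-form majorant of X, (2.148) ∕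
(2.81), (2.70), the change-of-domain smallness) — with the witnesses M₁ ≥ 2K_p^tow·K_TW(½δ) and
O(1) ≥ 2·3·2^d·B_C L^{d+p}·K_TW(½δ) UNIFORM IN THE NUMBER OF LEVELS (`prop27Printed_towerFamily`,
`prop23Printed_towerFamily`); (§4) non-vacuity on an INFINITE family of towers of every height k and every block size M
(`prop27Printed_diagonalTowerFamily`, `prop23Printed_diagonalTowerFamily`): with the scaled diagonal kernels
X(y, y″) = δ_{yy″}(L^jη)^{p−d}, C_□(y, y′) = δ_{yy′}□(y)(L^jη)^{−p−d} (B_X = B_C = 1, B_D = 0) every analytic binder is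
discharged too, so the census declarations hold on that family BY THE THEOREMS of §3 — the hypothesis packages are
consistent on genuinely multi-level data (k interfaces, cubes straddling them, `B6TowerCover.towerCover_nonvacuous`).

WHAT THIS MODULE PROVES.  §0 the diagonal kernels of the pairing (2.69) (`diagKer`, `kerOp_diagKer`, `mat_mulOp`) and
the analytic binders they satisfy on any geometry (`diag_hX`, `diag_h2148`, `diag_hCk0`, `diag_h270`, `diag_hinv`).
§1 `inverse_assembled_pow_towerBox`.  §2 `KtowerP`, `K285TLP_twGeo`, `K285TLP_twGeo_eq_KtowerP`, `KtowerP_nonneg`,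
`twGeo_len_pos`.  §3 `prop27Printed_towerFamily`, `prop23Printed_towerFamily`.  §4 `two_pow_le_exp`,
`prop27Printed_diagonalTowerFamily`, `prop23Printed_diagonalTowerFamily`.

TYPING ∕ DIVERGENCE (D-b06.43).  (i) The families of §3 share d, L and the rates and vary k, n, M, η, R and the kernels:
the printed O(1) of (2.87) ∕ (2.149) depends on d, L and the rates only, so this is the printed uniformity — except that
the cover constants still CARRY L (s ∝ L, m_g = 1∕(3L); D-b06.42 (iv), D-b06.41 (a) stand: the print's L-free O(1)
needs its rescaling argument, not modelled).  (ii) As in every B06 leaf the analytic inputs (2.142) ∕ (2.66)-majorant of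
X, (2.148) ∕ (2.81) for C_□, (2.70), the change-of-domain smallness and the located size condition L^p ≤ e^{⅛δ₀RM} are
HYPOTHESES (they are the business of Sect. C, Proposition 2.6 and [B5]); §4 only shows they are jointly satisfiable on
the tower family.  (iii) `twGeo` carries `Hyp21_22 := True`: the geometric hypotheses (2.1)–(2.2) are built into the
coordinatised tower (level separation RM ≤ nM + 1 proved, `B6LevelTower.twGeo_levelSep`), so the census binder
`(geo i).Hyp21_22 →` is trivial here.  (iv) j_□ := the finest level □ meets (D-b06.42 (ii)); the power-p exponent of
(2.148) ∕ (2.81) is read at the scale L^{j_□}η.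

HONEST SCOPE.  Bookkeeping ∕ modelling leaf: the printed Propositions 2.3 and 2.7, in the census typing, on the
multi-level tower family with every geometry and cover binder discharged and the analytic binders verbatim; thresholds
uniform in k.  NOT summit progress (no statement about continuum Yang–Mills or a mass gap is touched), NOT the printed
L-free O(1), NOT the continuum or infinite-volume limit, NOT a Clay-level claim.
-/

namespace Literature.MathematicalPhysics.QuantumFieldTheory.Balaban1983to89.B6TowerPrinted

open Finset Real
open B6Expansion282 (mulOp kerOp locOp Cglued R282 mulOp_apply kerOp_apply mulOp_mul_mulOp)
open B6Prop23Chain (mat)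
open B6Prop27Kernel (kappa2P kappa3P kappa4P)
open B6Prop23TwoLevel (prop23Printed_of_assembled_twoLevel mulOp_const_one)
open B6Prop27TwoLevel (K285TLP kappa4TLP K285TLP_four inverse_assembled_pow_twoLevel
  prop27Printed_of_assembled_twoLevel)
open B6LevelTower (TW twGeo twGeo_hyps266 twGeo_levelSep)
open B6TowerSums (Ktw Ktw_nonneg twGeo_ineq261With twGeo_ineq263With)
open B6TowerCover (Idx cubeInd hfun js sum_hfun_sq card_filter_hfun_ne_zero_le abs_hfun_sub_le cubeInd_zero_or_one
  cubeInd_mul_hfun gap_of_cubeInd_eq_zero js_spec inCube_of_cubeInd_ne_zero)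

/-! ## §0  Diagonal kernels in the pairing (2.69) and the analytic binders they satisfy -/

section Diagonal

/-- The DIAGONAL kernel with profile f in the scalar product (2.69): K_f(y, y″) = δ_{yy″}·f(y)∕(L^jη)^d — so that its
(2.69)-operator K_w(K_f) is multiplication by f (`kerOp_diagKer`); the data of the consistency models of §4.
[cite: Balaban1984PropagatorsII, (2.69) p.235] -/
noncomputable def diagKer (g : B6.Geometry) [DecidableEq g.Site] (d : ℕ) (f : g.Site → ℝ) (y y'' : g.Site) : ℝ :=
  if y = y'' then f y / g.len y ^ d else 0

/-- K_w(K_f) = multiplication by f, for the weights w = (L^jη)^d ≠ 0 of (2.69). [folklore] -/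
theorem kerOp_diagKer {g : B6.Geometry} [DecidableEq g.Site] (d : ℕ) (hlen : ∀ y, g.len y ≠ 0) (f : g.Site → ℝ) :
    kerOp (fun z => g.len z ^ d) (diagKer g d f) = mulOp f := by
  refine LinearMap.ext fun μ => funext fun y => ?_
  have h : g.len y ^ d ≠ 0 := pow_ne_zero d (hlen y)
  simp only [kerOp_apply, mulOp_apply, diagKer, mul_ite, mul_zero, ite_mul, zero_mul, Finset.sum_ite_eq,
    Finset.mem_univ, if_true]
  rw [show g.len y ^ d * (f y / g.len y ^ d) = f y by field_simp]

/-- The matrix of a multiplication operator in the basis of point masses is diagonal with entries f(y). [folklore] -/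
theorem mat_mulOp {S : Type} [Fintype S] [DecidableEq S] (f : S → ℝ) (y y' : S) :
    mat (mulOp f) y y' = if y = y' then f y else 0 := by
  unfold mat
  rw [mulOp_apply, Pi.single_apply]
  split_ifs <;> simp

/-- The (2.66)∕(2.142)-type majorant of the diagonal kernel X(y, y″) = δ_{yy″}(L^jη)^{p−d}: |(L^{j″}η)^d X(y, y″)| ≤
1·(L^jη)^p e^{−½δ₀d(y,y″)} (d(y, y) = 0). [cite: Balaban1984PropagatorsII, (2.66) p.235 + (2.142) p.248] -/
theorem diag_hX {g : B6.Geometry} [DecidableEq g.Site] (d p : ℕ) (hrefl : ∀ y, g.dist y y = 0)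
    (hlen : ∀ y, 0 < g.len y) {δ₀ : ℝ} (y y'' : g.Site) :
    |g.len y'' ^ d * diagKer g d (fun z => g.len z ^ p) y y''| ≤
      1 * g.len y ^ p * Real.exp (-(1 / 2 * δ₀ * g.dist y y'')) := by
  have hy := hlen y
  unfold diagKer
  split_ifs with h
  · subst h
    have hne : g.len y ^ d ≠ 0 := (pow_pos (hlen y) d).ne'
    rw [hrefl y, mul_zero, neg_zero, Real.exp_zero, mul_one, one_mul,
      show g.len y ^ d * (g.len y ^ p / g.len y ^ d) = g.len y ^ p by field_simp, abs_of_pos (pow_pos (hlen y) p)]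
  · rw [mul_zero, abs_zero]
    positivity

/-- The (2.81)∕(2.148)-type bound for the diagonal cube kernel C_□(y, y′) = δ_{yy′}□(y)(L^jη)^{−p−d}: on □ (so j_□ ≤ j,
L ≥ 1) |C_□(y, y′)| ≤ 1∕(L^{j_□}η)^{d+p}·e^{−δ₁d(y,y′)}. [cite: Balaban1984PropagatorsII, (2.81) p.237 + (2.148) p.249] -/
theorem diag_h2148 {g : B6.Geometry} [DecidableEq g.Site] (d p : ℕ) (hrefl : ∀ y, g.dist y y = 0) (hL : 1 ≤ g.L)
    (hη : 0 < g.eta) {D : Type} {pf : D → g.Site → ℝ} {jsc : D → ℕ} (hpf01 : ∀ a y, pf a y = 0 ∨ pf a y = 1)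
    (hcube : ∀ a y, pf a y ≠ 0 → jsc a ≤ g.scale y ∧ g.scale y ≤ jsc a + 1) {δ₁ : ℝ} (a : D) (y y' : g.Site)
    (hy : pf a y ≠ 0) (_hy' : pf a y' ≠ 0) :
    |diagKer g d (fun z => pf a z * (g.len z ^ p)⁻¹) y y'| ≤
      1 / (g.L ^ jsc a * g.eta) ^ (d + p) * Real.exp (-(δ₁ * g.dist y y')) := by
  have hL0 : 0 < g.L := zero_lt_one.trans_le hL
  have hb0 : 0 < g.L ^ jsc a * g.eta := mul_pos (pow_pos hL0 _) hη
  dsimp only [diagKer]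
  split_ifs with h
  · subst h
    have h1 : pf a y = 1 := (hpf01 a y).resolve_left hy
    have hlen : 0 < g.len y := mul_pos (pow_pos hL0 _) hη
    have hbase : g.L ^ jsc a * g.eta ≤ g.len y := by
      show g.L ^ jsc a * g.eta ≤ g.L ^ g.scale y * g.eta
      exact mul_le_mul_of_nonneg_right (pow_le_pow_right₀ hL (hcube a y hy).1) hη.le
    rw [hrefl y, mul_zero, neg_zero, Real.exp_zero, mul_one, h1, one_mul, ← one_div, div_div, ← pow_add,
      Nat.add_comm p d, abs_of_pos (by positivity)]
    exact one_div_le_one_div_of_le (pow_pos hb0 _) (pow_le_pow_left₀ hb0.le hbase _)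
  · rw [abs_zero]
    positivity

/-- The diagonal cube kernel vanishes off □ in its first argument (binder `hCk0`). [folklore] -/
theorem diag_hCk0 {g : B6.Geometry} [DecidableEq g.Site] (d p : ℕ) {D : Type} {pf : D → g.Site → ℝ} (a : D)
    (y'' y' : g.Site) (h : pf a y'' = 0) : diagKer g d (fun z => pf a z * (g.len z ^ p)⁻¹) y'' y' = 0 := by
  dsimp only [diagKer]
  rw [h, zero_mul, zero_div, ite_self]

/-- (2.70)∕(2.143) for the diagonal data: □X̃□·C_□·h_□ = h_□ with K_w(X̃) = multiplication by (L^jη)^p and K_w(C_□) =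
multiplication by □·(L^jη)^{−p} (□ ∈ {0, 1}, □h_□ = h_□). [cite: Balaban1984PropagatorsII, (2.70) p.235 + (2.143) p.248] -/
theorem diag_h270 {g : B6.Geometry} [DecidableEq g.Site] (d p : ℕ) (hlen : ∀ y, 0 < g.len y) {D : Type}
    (pf hf : D → g.Site → ℝ) (hpf01 : ∀ a y, pf a y = 0 ∨ pf a y = 1) (hph : ∀ a y, pf a y * hf a y = hf a y)
    (a : D) :
    locOp (fun a => mulOp (pf a)) (fun _ => kerOp (fun z => g.len z ^ d) (diagKer g d fun z => g.len z ^ p)) a *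
        kerOp (fun z => g.len z ^ d) (diagKer g d fun z => pf a z * (g.len z ^ p)⁻¹) * mulOp (hf a) =
      mulOp (hf a) := by
  have hne : ∀ y, g.len y ≠ 0 := fun y => (hlen y).ne'
  simp only [locOp, kerOp_diagKer d hne, mulOp_mul_mulOp]
  refine congrArg mulOp (funext fun y => ?_)
  have hF : g.len y ^ p ≠ 0 := pow_ne_zero p (hne y)
  rcases hpf01 a y with h0 | h1
  · have hh : hf a y = 0 := by rw [← hph a y, h0, zero_mul]
    rw [h0, hh]
    ring
  · rw [h1]
    field_simp

/-- The inverse of K_w(X), X the diagonal kernel with profile (L^jη)^p, is multiplication by (L^jη)^{−p}, and its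
(2.69)-kernel is the diagonal kernel with profile (L^jη)^{−p} (the dictionary binder `hinv`). [cite: Balaban1984PropagatorsII, (2.69) p.235] -/
theorem diag_hinv {g : B6.Geometry} [DecidableEq g.Site] (d p : ℕ) (hlen : ∀ y, 0 < g.len y) :
    ∃ G : Module.End ℝ (g.Site → ℝ), G * kerOp (fun z => g.len z ^ d) (diagKer g d fun z => g.len z ^ p) = 1 ∧
      ∀ y y', diagKer g d (fun z => (g.len z ^ p)⁻¹) y y' = mat G y y' / g.len y' ^ d := by
  have hne : ∀ y, g.len y ≠ 0 := fun y => (hlen y).ne'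
  refine ⟨mulOp fun z => (g.len z ^ p)⁻¹, ?_, fun y y' => ?_⟩
  · rw [kerOp_diagKer d hne, mulOp_mul_mulOp, ← mulOp_const_one (S := g.Site)]
    exact congrArg mulOp (funext fun y => inv_mul_cancel₀ (pow_ne_zero p (hne y)))
  · rw [mat_mulOp]
    unfold diagKer
    split_ifs with h
    · subst h
      rfl
    · rw [zero_div]

end Diagonal

/-! ## §1  Propositions 2.7 ∕ 2.3 at power p on the (k+1)-level tower with its cube cover, every k -/

section Edge

variable (d : ℕ) [NeZero d] (k n m L : ℕ) (η R : ℝ)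

/-- **PROPOSITION 2.7 (p = 2) ∕ PROPOSITION 2.3 (p = 4) AT POWER p ON THE (k+1)-LEVEL TOWER WITH ITS CUBE COVER, every
k** — `B6Prop27TwoLevel.inverse_assembled_pow_twoLevel` ((2.143)∕(2.82) ⟹ (2.85) with θ ≤ Kᵀᴸ_p∕M ⟹ *"for M large
enough"* ⟹ (2.86) ⟹ (2.149)∕(2.87), WITHOUT the single-level hypothesis) ON `twGeo d k (nM) M L η R` of `B6LevelTower`
(k + 1 levels of boxes of (nM + 1)^d sites, big blocks of M sites, scale ratio L) with the cover 𝒟 = ⋃_{l=0}^{k} 𝒟_l of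
`B6TowerCover`: □_i := `cubeInd m L i` (i = (l, c), c ∈ {0, …, n}^d), h_i := `hfun m L i`, j_□ := `js`, n₀ = 3·2^d.
DISCHARGED: htri ∕ hrefl ∕ hd (`B6LevelTower.twGeo_hyps266`), hsep ((2.2) with content RM ≤ nM + 1,
`twGeo_levelSep`), h261σ ∕ h261 ∕ h263 ∕ hc with the k-uniform constants K_TW of `B6TowerSums`, hM, and the cover
side hover, hpf01, hph, h236 ((2.36)), hLip (s = (1 + 3·2^{d+1})·(3π∕2)·L), hcube, hgap (m_g = 1∕(3L)) by
`B6TowerCover`; the model needs d ≥ 1, M ≥ 1, L ∈ ℕ with 1 ≤ L ≤ n, η > 0, 0 ≤ RM ≤ nM + 1.  Kept VERBATIM: the rates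
and their split, the located size condition L^p ≤ e^{⅛δ₀RM}, the kernels X ((2.142) resp. the (2.66)-majorant of
Q′G′²Q′\*), X̃_i, C_i with hX ∕ hXw ∕ hdom ∕ h2148 ((2.148) resp. (2.81), at the scale L^{j_□}η) ∕ hCk0 ∕ h270, and
«M large» hKM with the model's constants (K = `K285TLP`, = `K285TL` at p = 4 by `K285TLP_four`); conclusion verbatim:
the two-sided inverse of K_w(X), its glued form (2.86), uniqueness, and the bound (2.149)∕(2.87) with
O(1) = 2·3·2^d·B_C L^{d+p}·K_TW(½δ₁). [cite: Balaban1984PropagatorsII, Prop. 2.7 (2.143) p.248, (2.148)–(2.149) p.249; Prop. 2.3 (2.82)–(2.87) pp.237–238; (2.36) p.229] -/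
theorem inverse_assembled_pow_towerBox (p : ℕ) (hm : 0 < m) (hL : 1 ≤ L) (hLn : L ≤ n) (hη : 0 < η)
    (hR0 : 0 ≤ R * m) (hRa : R * m ≤ (n : ℝ) * m + 1)
    {δ₀ δ₁ σ c₃ BX BD BC : ℝ} (hδ₀ : 0 < δ₀) (hδ₁ : 0 < δ₁) (hsplit : δ₁ + σ * δ₀ ≤ δ₀ / 4) (hσ : 0 < σ * δ₀)
    (hthr : (L : ℝ) ^ p ≤ Real.exp (1 / 8 * δ₀ * R * m)) (hc₃ : 0 < c₃) (hBX : 0 ≤ BX) (hBD : 0 ≤ BD) (hBC : 0 ≤ BC)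
    {X : (twGeo d k (n * m) m L η R).Site → (twGeo d k (n * m) m L η R).Site → ℝ}
    {Xw Ck : Idx d k n → (twGeo d k (n * m) m L η R).Site → (twGeo d k (n * m) m L η R).Site → ℝ}
    (hX : ∀ y y'', |(twGeo d k (n * m) m L η R).len y'' ^ d * X y y''| ≤
      BX * (twGeo d k (n * m) m L η R).len y ^ p *
        Real.exp (-(1 / 2 * δ₀ * (twGeo d k (n * m) m L η R).dist y y'')))
    (hXw : ∀ i y y'', |(twGeo d k (n * m) m L η R).len y'' ^ d * Xw i y y''| ≤
      BX * (twGeo d k (n * m) m L η R).len y ^ p *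
        Real.exp (-(1 / 2 * δ₀ * (twGeo d k (n * m) m L η R).dist y y'')))
    (hdom : ∀ i y y'', |cubeInd m L i y * ((twGeo d k (n * m) m L η R).len y'' ^ d * (Xw i y y'' - X y y'')) *
        hfun m L i y''| ≤
      BD * Real.exp (-(c₃ * (twGeo d k (n * m) m L η R).M)) * (twGeo d k (n * m) m L η R).len y ^ p *
        Real.exp (-(1 / 2 * δ₀ * (twGeo d k (n * m) m L η R).dist y y'')))
    (h2148 : ∀ i y y', cubeInd m L i y ≠ 0 → cubeInd m L i y' ≠ 0 →
      |Ck i y y'| ≤ BC / ((twGeo d k (n * m) m L η R).L ^ js i * (twGeo d k (n * m) m L η R).eta) ^ (d + p) *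
        Real.exp (-(δ₁ * (twGeo d k (n * m) m L η R).dist y y')))
    (hCk0 : ∀ i y'' y', cubeInd m L i y'' = 0 → Ck i y'' y' = 0)
    (h270 : ∀ i, locOp (fun i => mulOp (cubeInd m L i))
        (fun i => kerOp (fun z => (twGeo d k (n * m) m L η R).len z ^ d) (Xw i)) i *
      kerOp (fun z => (twGeo d k (n * m) m L η R).len z ^ d) (Ck i) * mulOp (hfun m L i) = mulOp (hfun m L i))
    (hKM : 2 * K285TLP (twGeo d k (n * m) m L η R) d p (3 * 2 ^ d) ((1 + 3 * 2 ^ (d + 1)) * (3 * π / 2) * L) δ₀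
      (Ktw d L (σ * δ₀)) c₃ (1 / (3 * (L : ℝ))) BX BD BC * Ktw d L (1 / 2 * δ₁) ≤ (twGeo d k (n * m) m L η R).M) :
    ∃ G : Module.End ℝ ((twGeo d k (n * m) m L η R).Site → ℝ),
      G * kerOp (fun z => (twGeo d k (n * m) m L η R).len z ^ d) X = 1 ∧
      kerOp (fun z => (twGeo d k (n * m) m L η R).len z ^ d) X * G = 1 ∧
      G = Cglued (fun i => mulOp (hfun m L i)) (fun i => kerOp (fun z => (twGeo d k (n * m) m L η R).len z ^ d) (Ck i)) +
        G * R282 (kerOp (fun z => (twGeo d k (n * m) m L η R).len z ^ d) X) (fun i => mulOp (cubeInd m L i))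
          (fun i => kerOp (fun z => (twGeo d k (n * m) m L η R).len z ^ d) (Xw i)) (fun i => mulOp (hfun m L i))
          (fun i => kerOp (fun z => (twGeo d k (n * m) m L η R).len z ^ d) (Ck i)) ∧
      (∀ G' : Module.End ℝ ((twGeo d k (n * m) m L η R).Site → ℝ),
        G' * kerOp (fun z => (twGeo d k (n * m) m L η R).len z ^ d) X = 1 → G' = G) ∧
      ∀ y y', |mat G y y' / (twGeo d k (n * m) m L η R).len y' ^ d| ≤
        2 * ((3 * 2 ^ d : ℕ) * (BC * (twGeo d k (n * m) m L η R).L ^ (d + p))) * Ktw d L (1 / 2 * δ₁) *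
          (twGeo d k (n * m) m L η R).len y ^ (-(p : ℝ)) * (twGeo d k (n * m) m L η R).len y' ^ (-(d : ℝ)) *
          Real.exp (-(δ₁ / 2 * (twGeo d k (n * m) m L η R).dist y y')) := by
  have hn1 : 1 ≤ n := le_trans hL hLn
  have hLr : (1 : ℝ) ≤ (L : ℝ) := by exact_mod_cast hL
  have hd0 : 0 < d := Nat.pos_of_ne_zero (NeZero.ne d)
  have hM : 0 < (twGeo d k (n * m) m L η R).M := by
    show (0 : ℝ) < m
    exact_mod_cast hm
  have hRa' : R * m ≤ ((n * m : ℕ) : ℝ) + 1 := by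
    push_cast
    exact hRa
  have hδhalf : 0 < 1 / 2 * δ₁ := by linarith
  obtain ⟨htri, hrefl, hd⟩ := twGeo_hyps266 d k (n * m) m L η R
  exact inverse_assembled_pow_twoLevel (g := twGeo d k (n * m) m L η R) (D := Idx d k n) (pf := cubeInd m L)
    (hf := hfun m L) (js := js) (n₀ := 3 * 2 ^ d) d p htri hrefl hd
    (twGeo_levelSep d k (n * m) m L η R hL hRa') hLr hη hM hR0 hδ₀ hδ₁.le hsplit
    (twGeo_ineq261With d k (n * m) m L η R hL hσ) hthr
    (twGeo_ineq261With d k (n * m) m L η R hL hδhalf)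
    (twGeo_ineq263With d k (n * m) m L η R hL hδhalf hδ₁.le (by norm_num)) (Ktw_nonneg d L hδhalf hd0) hc₃
    (by positivity) (by positivity) hBX hBD hBC
    (fun y => card_filter_hfun_ne_zero_le hm hL hLn y) (cubeInd_zero_or_one m L) (cubeInd_mul_hfun hm L)
    (sum_hfun_sq hm hL) (abs_hfun_sub_le hm hL hLn)
    (fun _ _ h => js_spec hL hLn (inCube_of_cubeInd_ne_zero h))
    (fun _ _ _ hy hy'' => gap_of_cubeInd_eq_zero hm hL hn1 hy hy'') hX hXw hdom h2148 hCk0 h270 hKM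

end Edge

/-! ## §2  The threshold constant of the tower depends on the geometry through L only: uniform in k -/

section Constants

variable (d : ℕ) [NeZero d] (k a m L : ℕ) (η R : ℝ)

/-- **K_p^tow(d, L; δ₀, σ, c₃, B_X, B_D, B_C)** — the constant Kᵀᴸ_p of θ ≤ Kᵀᴸ_p∕M ((2.85), *"for M large enough"*)
READ ON A TOWER with the tower cover's bookkeeping (n₀ = 3·2^d, s = (1 + 3·2^{d+1})(3π∕2)L, c_σ = K_TW(σδ₀),
m_g = 1∕(3L)); by `K285TLP_twGeo` it is the same number on every tower with scale ratio L — every height k, box side,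
M, η, R. [cite: Balaban1984PropagatorsII, (2.85) «O(M⁻¹)» p.238 + p.249] -/
noncomputable def KtowerP (p : ℕ) (δ₀ σ c₃ BX BD BC : ℝ) : ℝ :=
  K285TLP (twGeo d 0 0 1 L 1 0) d p (3 * 2 ^ d) ((1 + 3 * 2 ^ (d + 1)) * (3 * π / 2) * L) δ₀ (Ktw d L (σ * δ₀)) c₃
    (1 / (3 * (L : ℝ))) BX BD BC

/-- **THE THRESHOLD CONSTANT IS UNIFORM IN THE NUMBER OF LEVELS**: Kᵀᴸ_p (`B6Prop27TwoLevel.K285TLP`) evaluated on a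
tower geometry depends on it only through the scale ratio L — two towers of any heights k, k′, box sides, block sizes,
η, R give the same constant (definitionally). [cite: Balaban1984PropagatorsII, (2.85) p.238 + Lemma 2.1 p.234] -/
theorem K285TLP_twGeo (p n₀ : ℕ) (s δ₀ cσ c₃ mg BX BD BC : ℝ) (k' a' m' : ℕ) (η' R' : ℝ) :
    K285TLP (twGeo d k a m L η R) d p n₀ s δ₀ cσ c₃ mg BX BD BC =
      K285TLP (twGeo d k' a' m' L η' R') d p n₀ s δ₀ cσ c₃ mg BX BD BC := rfl

/-- The «M large» constant of `inverse_assembled_pow_towerBox` on `twGeo d k a M L η R` IS K_p^tow(d, L; rates), for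
every k, a, M, η, R. [cite: Balaban1984PropagatorsII, (2.85) p.238] -/
theorem K285TLP_twGeo_eq_KtowerP (p : ℕ) (δ₀ σ c₃ BX BD BC : ℝ) :
    K285TLP (twGeo d k a m L η R) d p (3 * 2 ^ d) ((1 + 3 * 2 ^ (d + 1)) * (3 * π / 2) * L) δ₀ (Ktw d L (σ * δ₀))
      c₃ (1 / (3 * (L : ℝ))) BX BD BC = KtowerP d L p δ₀ σ c₃ BX BD BC := rfl

/-- K_p^tow ≥ 0 for non-negative sizes and rates (σδ₀ > 0 for K_TW). [folklore] -/
theorem KtowerP_nonneg (p : ℕ) {δ₀ σ c₃ BX BD BC : ℝ} (hδ₀ : 0 ≤ δ₀) (hσ : 0 < σ * δ₀) (hc₃ : 0 ≤ c₃)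
    (hBX : 0 ≤ BX) (hBD : 0 ≤ BD) (hBC : 0 ≤ BC) : 0 ≤ KtowerP d L p δ₀ σ c₃ BX BD BC := by
  have hd0 : 0 < d := Nat.pos_of_ne_zero (NeZero.ne d)
  have hK : 0 ≤ Ktw d L (σ * δ₀) := Ktw_nonneg d L hσ hd0
  have hL0 : (0 : ℝ) ≤ (twGeo d 0 0 1 L 1 0).L := Nat.cast_nonneg L
  unfold KtowerP K285TLP kappa2P kappa3P kappa4TLP kappa4P
  positivity

/-- L^jη > 0 on the tower (L ≥ 1, η > 0). [folklore] -/
theorem twGeo_len_pos (hL : 1 ≤ L) (hη : 0 < η) (y : TW d k a) : 0 < (twGeo d k a m L η R).len y := by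
  have hL0 : (0 : ℝ) < (L : ℝ) := by exact_mod_cast (zero_lt_one.trans_le hL)
  exact mul_pos (pow_pos hL0 _) hη

end Constants

/-! ## §3  `B6.Prop27Printed` ∕ `B6.Prop23Printed` on every tower family, witnesses uniform in the number of levels -/

section Family

variable (d : ℕ) [NeZero d] (L : ℕ)

/-- **PROPOSITION 2.7 IN ITS PRINTED TYPING ON EVERY FAMILY OF MULTI-LEVEL TOWERS, WITNESSES UNIFORM IN k** — the
census declaration `B6.Prop27Printed d geo Qinv` for geo_i := `twGeo d k_i (n_iM_i) M_i L η_i R_i` (towers of ANY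
heights k_i with their cube covers 𝒟; d, L, the rates δ₀, δ₄, σ, c₃ and the sizes B_X, B_D, B_C common; k_i, n_i, M_i,
η_i, R_i and the kernels free), from `B6Prop27TwoLevel.prop27Printed_of_assembled_twoLevel` with EVERY geometry and cover
binder discharged (§1).  Hypotheses kept: per member M_i ≥ 1, L ≤ n_i, η_i > 0, 0 ≤ R_iM_i ≤ n_iM_i + 1, the located
size condition L² ≤ e^{⅛δ₀R_iM_i} above the threshold, the kernels X_i = QGQ\* with (2.142), X̃_{i,□} = QG_□Q\*, C_{i,□}
with (2.148) (at the scale L^{j_□}η), the change-of-domain smallness, (2.70), the dictionary «`Qinv i` is the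
(2.69)-kernel of an inverse of X_i whenever M₁ ≤ M_i»; and TWO NUMBERS: a threshold M₁ ≥ 2K₂^tow(d, L; rates)·K_TW(½δ₄)
and an O(1) ≥ 2·3·2^d·B_C L^{d+2}·K_TW(½δ₄) — the SAME for every member, whatever its number of levels (`KtowerP`,
`K285TLP_twGeo`).  Conclusion: the printed Proposition 2.7 with witnesses (M₁, δ₄, O(1)). [cite: Balaban1984PropagatorsII, Prop. 2.7 (2.142)–(2.143) p.248, (2.148)–(2.149) p.249 + (2.85) p.238] -/
theorem prop27Printed_towerFamily {I : Type} (kk nn mm : I → ℕ) (ηη RR : I → ℝ)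
    (Qinv : ∀ i, B6.SiteKernel (twGeo d (kk i) (nn i * mm i) (mm i) L (ηη i) (RR i)))
    (hm : ∀ i, 0 < mm i) (hL : 1 ≤ L) (hLn : ∀ i, L ≤ nn i) (hη : ∀ i, 0 < ηη i)
    (hR0 : ∀ i, 0 ≤ RR i * mm i) (hRa : ∀ i, RR i * mm i ≤ (nn i : ℝ) * mm i + 1)
    {δ₀ δ₄ σ c₃ BX BD BC M₁ C : ℝ} (hδ₀ : 0 < δ₀) (hδ₄ : 0 < δ₄) (hsplit : δ₄ + σ * δ₀ ≤ δ₀ / 4)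
    (hσ : 0 < σ * δ₀)
    (hthr : ∀ i, M₁ ≤ (mm i : ℝ) → (L : ℝ) ^ 2 ≤ Real.exp (1 / 8 * δ₀ * RR i * mm i))
    (hc₃ : 0 < c₃) (hBX : 0 ≤ BX) (hBD : 0 ≤ BD) (hBC : 0 ≤ BC) (hM₁ : 0 < M₁) (hC : 0 < C)
    (hKM : 2 * KtowerP d L 2 δ₀ σ c₃ BX BD BC * Ktw d L (1 / 2 * δ₄) ≤ M₁)
    (hCB : 2 * ((3 * 2 ^ d : ℕ) * (BC * (L : ℝ) ^ (d + 2))) * Ktw d L (1 / 2 * δ₄) ≤ C)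
    {X : ∀ i, (twGeo d (kk i) (nn i * mm i) (mm i) L (ηη i) (RR i)).Site →
      (twGeo d (kk i) (nn i * mm i) (mm i) L (ηη i) (RR i)).Site → ℝ}
    {Xw Ck : ∀ i, Idx d (kk i) (nn i) → (twGeo d (kk i) (nn i * mm i) (mm i) L (ηη i) (RR i)).Site →
      (twGeo d (kk i) (nn i * mm i) (mm i) L (ηη i) (RR i)).Site → ℝ}
    (hX : ∀ i y y'', |(twGeo d (kk i) (nn i * mm i) (mm i) L (ηη i) (RR i)).len y'' ^ d * X i y y''| ≤
      BX * (twGeo d (kk i) (nn i * mm i) (mm i) L (ηη i) (RR i)).len y ^ 2 *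
        Real.exp (-(1 / 2 * δ₀ * (twGeo d (kk i) (nn i * mm i) (mm i) L (ηη i) (RR i)).dist y y'')))
    (hXw : ∀ i q y y'', |(twGeo d (kk i) (nn i * mm i) (mm i) L (ηη i) (RR i)).len y'' ^ d * Xw i q y y''| ≤
      BX * (twGeo d (kk i) (nn i * mm i) (mm i) L (ηη i) (RR i)).len y ^ 2 *
        Real.exp (-(1 / 2 * δ₀ * (twGeo d (kk i) (nn i * mm i) (mm i) L (ηη i) (RR i)).dist y y'')))
    (hdom : ∀ i q y y'', |cubeInd (mm i) L q y *
        ((twGeo d (kk i) (nn i * mm i) (mm i) L (ηη i) (RR i)).len y'' ^ d * (Xw i q y y'' - X i y y'')) *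
        hfun (mm i) L q y''| ≤
      BD * Real.exp (-(c₃ * (twGeo d (kk i) (nn i * mm i) (mm i) L (ηη i) (RR i)).M)) *
        (twGeo d (kk i) (nn i * mm i) (mm i) L (ηη i) (RR i)).len y ^ 2 *
        Real.exp (-(1 / 2 * δ₀ * (twGeo d (kk i) (nn i * mm i) (mm i) L (ηη i) (RR i)).dist y y'')))
    (h2148 : ∀ i q y y', cubeInd (mm i) L q y ≠ 0 → cubeInd (mm i) L q y' ≠ 0 →
      |Ck i q y y'| ≤ BC / ((twGeo d (kk i) (nn i * mm i) (mm i) L (ηη i) (RR i)).L ^ js q *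
          (twGeo d (kk i) (nn i * mm i) (mm i) L (ηη i) (RR i)).eta) ^ (d + 2) *
        Real.exp (-(δ₄ * (twGeo d (kk i) (nn i * mm i) (mm i) L (ηη i) (RR i)).dist y y')))
    (hCk0 : ∀ i q y'' y', cubeInd (mm i) L q y'' = 0 → Ck i q y'' y' = 0)
    (h270 : ∀ i q, locOp (fun q => mulOp (cubeInd (mm i) L q))
        (fun q => kerOp (fun z => (twGeo d (kk i) (nn i * mm i) (mm i) L (ηη i) (RR i)).len z ^ d) (Xw i q)) q *
      kerOp (fun z => (twGeo d (kk i) (nn i * mm i) (mm i) L (ηη i) (RR i)).len z ^ d) (Ck i q) *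
        mulOp (hfun (mm i) L q) = mulOp (hfun (mm i) L q))
    (hinv : ∀ i, M₁ ≤ (mm i : ℝ) →
      ∃ G : Module.End ℝ ((twGeo d (kk i) (nn i * mm i) (mm i) L (ηη i) (RR i)).Site → ℝ),
        G * kerOp (fun z => (twGeo d (kk i) (nn i * mm i) (mm i) L (ηη i) (RR i)).len z ^ d) (X i) = 1 ∧
        ∀ y y', (Qinv i).ker y y' =
          mat G y y' / (twGeo d (kk i) (nn i * mm i) (mm i) L (ηη i) (RR i)).len y' ^ d) :
    B6.Prop27Printed d (fun i => twGeo d (kk i) (nn i * mm i) (mm i) L (ηη i) (RR i)) Qinv := by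
  have hd0 : 0 < d := Nat.pos_of_ne_zero (NeZero.ne d)
  have hLr : (1 : ℝ) ≤ (L : ℝ) := by exact_mod_cast hL
  have hδhalf : 0 < 1 / 2 * δ₄ := by linarith
  exact prop27Printed_of_assembled_twoLevel (geo := fun i => twGeo d (kk i) (nn i * mm i) (mm i) L (ηη i) (RR i))
    (D := fun i => Idx d (kk i) (nn i)) (pf := fun i => cubeInd (mm i) L) (hf := fun i => hfun (mm i) L)
    (js := fun _ => js) (n₀ := 3 * 2 ^ d) (s := (1 + 3 * 2 ^ (d + 1)) * (3 * π / 2) * L)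
    (cσ := Ktw d L (σ * δ₀)) (c := Ktw d L (1 / 2 * δ₄)) (mg := 1 / (3 * (L : ℝ))) d Qinv
    (fun i => (twGeo_hyps266 d (kk i) (nn i * mm i) (mm i) L (ηη i) (RR i)).1)
    (fun i => (twGeo_hyps266 d (kk i) (nn i * mm i) (mm i) L (ηη i) (RR i)).2.1)
    (fun i => (twGeo_hyps266 d (kk i) (nn i * mm i) (mm i) L (ηη i) (RR i)).2.2)
    (fun i => twGeo_levelSep d (kk i) (nn i * mm i) (mm i) L (ηη i) (RR i) hL (by push_cast; exact hRa i))
    (fun _ => hLr) hη (fun i => by show (0 : ℝ) < (mm i : ℝ); exact_mod_cast hm i) hR0 hδ₀ hδ₄ hsplit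
    (fun i => twGeo_ineq261With d (kk i) (nn i * mm i) (mm i) L (ηη i) (RR i) hL hσ) hthr
    (fun i => twGeo_ineq261With d (kk i) (nn i * mm i) (mm i) L (ηη i) (RR i) hL hδhalf)
    (fun i => twGeo_ineq263With d (kk i) (nn i * mm i) (mm i) L (ηη i) (RR i) hL hδhalf hδ₄.le (by norm_num))
    (Ktw_nonneg d L hδhalf hd0) hc₃ (by positivity) (by positivity) hBX hBD hBC hM₁ hC
    (fun i => by rw [K285TLP_twGeo_eq_KtowerP]; exact hKM) (fun _ => hCB)
    (fun i y => card_filter_hfun_ne_zero_le (hm i) hL (hLn i) y) (fun i => cubeInd_zero_or_one (mm i) L)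
    (fun i => cubeInd_mul_hfun (hm i) L) (fun i => sum_hfun_sq (hm i) hL)
    (fun i => abs_hfun_sub_le (hm i) hL (hLn i))
    (fun i _ _ h => js_spec hL (hLn i) (inCube_of_cubeInd_ne_zero h))
    (fun i _ _ _ hy hy'' => gap_of_cubeInd_eq_zero (hm i) hL (le_trans hL (hLn i)) hy hy'') hX hXw hdom h2148 hCk0
    h270 hinv

/-- **PROPOSITION 2.3 IN ITS PRINTED TYPING ON EVERY FAMILY OF MULTI-LEVEL TOWERS, WITNESSES UNIFORM IN k** — the
census declaration `B6.Prop23Printed d geo Cinv` for geo_i := `twGeo d k_i (n_iM_i) M_i L η_i R_i`, from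
`B6Prop23TwoLevel.prop23Printed_of_assembled_twoLevel` (p = 4, threshold constant `K285TL` = `K285TLP … 4` by
`K285TLP_four`) with EVERY geometry and cover binder discharged; hypotheses kept as in `prop27Printed_towerFamily` with
the powers +4 ∕ −4 (X_i = Q′G′²Q′\* with its (2.66)-majorant, C_{i,□} with (2.81)), L⁴ ≤ e^{⅛δ₀R_iM_i} above the
threshold, and the two k-UNIFORM numbers M₁ ≥ 2K₄^tow·K_TW(½δ₁), O(1) ≥ 2·3·2^d·B_C L^{d+4}·K_TW(½δ₁).
[cite: Balaban1984PropagatorsII, Prop. 2.3 (2.82)–(2.87) pp.237–238 + p.235] -/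
theorem prop23Printed_towerFamily {I : Type} (kk nn mm : I → ℕ) (ηη RR : I → ℝ)
    (Cinv : ∀ i, B6.SiteKernel (twGeo d (kk i) (nn i * mm i) (mm i) L (ηη i) (RR i)))
    (hm : ∀ i, 0 < mm i) (hL : 1 ≤ L) (hLn : ∀ i, L ≤ nn i) (hη : ∀ i, 0 < ηη i)
    (hR0 : ∀ i, 0 ≤ RR i * mm i) (hRa : ∀ i, RR i * mm i ≤ (nn i : ℝ) * mm i + 1)
    {δ₀ δ₁ σ c₃ BX BD BC M₁ C : ℝ} (hδ₀ : 0 < δ₀) (hδ₁ : 0 < δ₁) (hsplit : δ₁ + σ * δ₀ ≤ δ₀ / 4)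
    (hσ : 0 < σ * δ₀)
    (hthr : ∀ i, M₁ ≤ (mm i : ℝ) → (L : ℝ) ^ 4 ≤ Real.exp (1 / 8 * δ₀ * RR i * mm i))
    (hc₃ : 0 < c₃) (hBX : 0 ≤ BX) (hBD : 0 ≤ BD) (hBC : 0 ≤ BC) (hM₁ : 0 < M₁) (hC : 0 < C)
    (hKM : 2 * KtowerP d L 4 δ₀ σ c₃ BX BD BC * Ktw d L (1 / 2 * δ₁) ≤ M₁)
    (hCB : 2 * ((3 * 2 ^ d : ℕ) * (BC * (L : ℝ) ^ (d + 4))) * Ktw d L (1 / 2 * δ₁) ≤ C)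
    {X : ∀ i, (twGeo d (kk i) (nn i * mm i) (mm i) L (ηη i) (RR i)).Site →
      (twGeo d (kk i) (nn i * mm i) (mm i) L (ηη i) (RR i)).Site → ℝ}
    {Xw Ck : ∀ i, Idx d (kk i) (nn i) → (twGeo d (kk i) (nn i * mm i) (mm i) L (ηη i) (RR i)).Site →
      (twGeo d (kk i) (nn i * mm i) (mm i) L (ηη i) (RR i)).Site → ℝ}
    (hX : ∀ i y y'', |(twGeo d (kk i) (nn i * mm i) (mm i) L (ηη i) (RR i)).len y'' ^ d * X i y y''| ≤
      BX * (twGeo d (kk i) (nn i * mm i) (mm i) L (ηη i) (RR i)).len y ^ 4 *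
        Real.exp (-(1 / 2 * δ₀ * (twGeo d (kk i) (nn i * mm i) (mm i) L (ηη i) (RR i)).dist y y'')))
    (hXw : ∀ i q y y'', |(twGeo d (kk i) (nn i * mm i) (mm i) L (ηη i) (RR i)).len y'' ^ d * Xw i q y y''| ≤
      BX * (twGeo d (kk i) (nn i * mm i) (mm i) L (ηη i) (RR i)).len y ^ 4 *
        Real.exp (-(1 / 2 * δ₀ * (twGeo d (kk i) (nn i * mm i) (mm i) L (ηη i) (RR i)).dist y y'')))
    (hdom : ∀ i q y y'', |cubeInd (mm i) L q y *
        ((twGeo d (kk i) (nn i * mm i) (mm i) L (ηη i) (RR i)).len y'' ^ d * (Xw i q y y'' - X i y y'')) *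
        hfun (mm i) L q y''| ≤
      BD * Real.exp (-(c₃ * (twGeo d (kk i) (nn i * mm i) (mm i) L (ηη i) (RR i)).M)) *
        (twGeo d (kk i) (nn i * mm i) (mm i) L (ηη i) (RR i)).len y ^ 4 *
        Real.exp (-(1 / 2 * δ₀ * (twGeo d (kk i) (nn i * mm i) (mm i) L (ηη i) (RR i)).dist y y'')))
    (h281 : ∀ i q y y', cubeInd (mm i) L q y ≠ 0 → cubeInd (mm i) L q y' ≠ 0 →
      |Ck i q y y'| ≤ BC / ((twGeo d (kk i) (nn i * mm i) (mm i) L (ηη i) (RR i)).L ^ js q *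
          (twGeo d (kk i) (nn i * mm i) (mm i) L (ηη i) (RR i)).eta) ^ (d + 4) *
        Real.exp (-(δ₁ * (twGeo d (kk i) (nn i * mm i) (mm i) L (ηη i) (RR i)).dist y y')))
    (hCk0 : ∀ i q y'' y', cubeInd (mm i) L q y'' = 0 → Ck i q y'' y' = 0)
    (h270 : ∀ i q, locOp (fun q => mulOp (cubeInd (mm i) L q))
        (fun q => kerOp (fun z => (twGeo d (kk i) (nn i * mm i) (mm i) L (ηη i) (RR i)).len z ^ d) (Xw i q)) q *
      kerOp (fun z => (twGeo d (kk i) (nn i * mm i) (mm i) L (ηη i) (RR i)).len z ^ d) (Ck i q) *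
        mulOp (hfun (mm i) L q) = mulOp (hfun (mm i) L q))
    (hinv : ∀ i, M₁ ≤ (mm i : ℝ) →
      ∃ G : Module.End ℝ ((twGeo d (kk i) (nn i * mm i) (mm i) L (ηη i) (RR i)).Site → ℝ),
        G * kerOp (fun z => (twGeo d (kk i) (nn i * mm i) (mm i) L (ηη i) (RR i)).len z ^ d) (X i) = 1 ∧
        ∀ y y', (Cinv i).ker y y' =
          mat G y y' / (twGeo d (kk i) (nn i * mm i) (mm i) L (ηη i) (RR i)).len y' ^ d) :
    B6.Prop23Printed d (fun i => twGeo d (kk i) (nn i * mm i) (mm i) L (ηη i) (RR i)) Cinv := by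
  have hd0 : 0 < d := Nat.pos_of_ne_zero (NeZero.ne d)
  have hLr : (1 : ℝ) ≤ (L : ℝ) := by exact_mod_cast hL
  have hδhalf : 0 < 1 / 2 * δ₁ := by linarith
  exact prop23Printed_of_assembled_twoLevel (geo := fun i => twGeo d (kk i) (nn i * mm i) (mm i) L (ηη i) (RR i))
    (D := fun i => Idx d (kk i) (nn i)) (pf := fun i => cubeInd (mm i) L) (hf := fun i => hfun (mm i) L)
    (js := fun _ => js) (n₀ := 3 * 2 ^ d) (s := (1 + 3 * 2 ^ (d + 1)) * (3 * π / 2) * L)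
    (cσ := Ktw d L (σ * δ₀)) (c := Ktw d L (1 / 2 * δ₁)) (mg := 1 / (3 * (L : ℝ))) d Cinv
    (fun i => (twGeo_hyps266 d (kk i) (nn i * mm i) (mm i) L (ηη i) (RR i)).1)
    (fun i => (twGeo_hyps266 d (kk i) (nn i * mm i) (mm i) L (ηη i) (RR i)).2.1)
    (fun i => (twGeo_hyps266 d (kk i) (nn i * mm i) (mm i) L (ηη i) (RR i)).2.2)
    (fun i => twGeo_levelSep d (kk i) (nn i * mm i) (mm i) L (ηη i) (RR i) hL (by push_cast; exact hRa i))
    (fun _ => hLr) hη (fun i => by show (0 : ℝ) < (mm i : ℝ); exact_mod_cast hm i) hR0 hδ₀ hδ₁ hsplit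
    (fun i => twGeo_ineq261With d (kk i) (nn i * mm i) (mm i) L (ηη i) (RR i) hL hσ) hthr
    (fun i => twGeo_ineq261With d (kk i) (nn i * mm i) (mm i) L (ηη i) (RR i) hL hδhalf)
    (fun i => twGeo_ineq263With d (kk i) (nn i * mm i) (mm i) L (ηη i) (RR i) hL hδhalf hδ₁.le (by norm_num))
    (Ktw_nonneg d L hδhalf hd0) hc₃ (by positivity) (by positivity) hBX hBD hBC hM₁ hC
    (fun i => by rw [← K285TLP_four, K285TLP_twGeo_eq_KtowerP]; exact hKM) (fun _ => hCB)
    (fun i y => card_filter_hfun_ne_zero_le (hm i) hL (hLn i) y) (fun i => cubeInd_zero_or_one (mm i) L)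
    (fun i => cubeInd_mul_hfun (hm i) L) (fun i => sum_hfun_sq (hm i) hL)
    (fun i => abs_hfun_sub_le (hm i) hL (hLn i))
    (fun i _ _ h => js_spec hL (hLn i) (inCube_of_cubeInd_ne_zero h))
    (fun i _ _ _ hy hy'' => gap_of_cubeInd_eq_zero (hm i) hL (le_trans hL (hLn i)) hy hy'') hX hXw hdom h281 hCk0
    h270 hinv

end Family

/-! ## §4  Non-vacuity: the census declarations on an infinite family of towers of every height -/

/-- 2^p ≤ e^{⅛·8·5·(m′+1)} for p ≤ 5 (e ≥ 2): the located size condition L^p ≤ e^{⅛δ₀RM} of the diagonal family (L = 2,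
δ₀ = 8, R = 5, M = m′ + 1). [folklore] -/
theorem two_pow_le_exp {p : ℕ} (hp : p ≤ 5) (m' : ℕ) :
    ((2 : ℕ) : ℝ) ^ p ≤ Real.exp (1 / 8 * 8 * 5 * ((m' + 1 : ℕ) : ℝ)) := by
  have h2e : (2 : ℝ) ≤ Real.exp 1 := by
    have := Real.add_one_le_exp (1 : ℝ); norm_num at this ⊢; linarith
  have hm : (1 : ℝ) ≤ ((m' + 1 : ℕ) : ℝ) := by exact_mod_cast Nat.succ_pos m'
  calc ((2 : ℕ) : ℝ) ^ p = (2 : ℝ) ^ p := by norm_num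
    _ ≤ (2 : ℝ) ^ 5 := pow_le_pow_right₀ one_le_two hp
    _ ≤ Real.exp 1 ^ 5 := pow_le_pow_left₀ (by norm_num) h2e 5
    _ = Real.exp 5 := by rw [← Real.exp_nat_mul]; norm_num
    _ ≤ Real.exp (1 / 8 * 8 * 5 * ((m' + 1 : ℕ) : ℝ)) := Real.exp_le_exp.mpr (by linarith)

/-- **NON-VACUITY OF `prop27Printed_towerFamily` ON AN INFINITE TOWER FAMILY**: on the family indexed by
(k, m′) ∈ ℕ × ℕ of towers `twGeo 1 k (5(m′+1)) (m′+1) 2 1 5` — EVERY number of levels k + 1, every block size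
M = m′ + 1; d = 1, n = 5, L = 2, η = 1, R = 5 — with their cube covers 𝒟 and the scaled diagonal kernels
X = X̃_□ : δ_{yy″}(L^jη)^{2−d}, C_□ : δ_{yy′}□(y)(L^jη)^{−2−d} (B_X = B_C = 1, B_D = 0, δ₀ = 8, δ₄ = 1, σ = ⅛, c₃ = 1),
Qinv := the (2.69)-kernel of K_w(X)^{−1}, M₁ := 2K₂^tow·K_TW(½) + 1, O(1) := 2·6·2³·K_TW(½) + 1, every hypothesis of
`prop27Printed_towerFamily` is discharged — the term below is that theorem applied there —, so `B6.Prop27Printed` holds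
on a family of genuinely multi-level situations by this route. [folklore] -/
theorem prop27Printed_diagonalTowerFamily :
    B6.Prop27Printed 1 (fun i : ℕ × ℕ => twGeo 1 i.1 (5 * (i.2 + 1)) (i.2 + 1) 2 1 5)
      (fun i => ⟨diagKer (twGeo 1 i.1 (5 * (i.2 + 1)) (i.2 + 1) 2 1 5) 1
        fun z => ((twGeo 1 i.1 (5 * (i.2 + 1)) (i.2 + 1) 2 1 5).len z ^ 2)⁻¹⟩) := by
  have hlen : ∀ (i : ℕ × ℕ) (y : (twGeo 1 i.1 (5 * (i.2 + 1)) (i.2 + 1) 2 1 5).Site),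
      0 < (twGeo 1 i.1 (5 * (i.2 + 1)) (i.2 + 1) 2 1 5).len y :=
    fun i y => twGeo_len_pos 1 i.1 (5 * (i.2 + 1)) (i.2 + 1) 2 1 5 (by norm_num) one_pos y
  have hrefl : ∀ (i : ℕ × ℕ) (y : (twGeo 1 i.1 (5 * (i.2 + 1)) (i.2 + 1) 2 1 5).Site),
      (twGeo 1 i.1 (5 * (i.2 + 1)) (i.2 + 1) 2 1 5).dist y y = 0 :=
    fun i => (twGeo_hyps266 1 i.1 (5 * (i.2 + 1)) (i.2 + 1) 2 1 5).2.1
  have hL1 : ∀ i : ℕ × ℕ, 1 ≤ (twGeo 1 i.1 (5 * (i.2 + 1)) (i.2 + 1) 2 1 5).L := fun _ => by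
    show (1 : ℝ) ≤ ((2 : ℕ) : ℝ)
    norm_num
  have hc : 0 ≤ Ktw 1 2 (1 / 2 * 1) := Ktw_nonneg 1 2 (by norm_num) one_pos
  have hK : 0 ≤ KtowerP 1 2 2 8 (1 / 8) 1 1 0 1 :=
    KtowerP_nonneg 1 2 2 (by norm_num) (by norm_num) zero_le_one zero_le_one le_rfl zero_le_one
  refine prop27Printed_towerFamily 1 2 (fun i : ℕ × ℕ => i.1) (fun _ => 5) (fun i => i.2 + 1) (fun _ => 1)
    (fun _ => 5) _ (fun i => Nat.succ_pos i.2) (by norm_num) (fun _ => ?_) (fun _ => one_pos) (fun i => ?_)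
    (fun i => ?_) (δ₀ := 8) (δ₄ := 1) (σ := 1 / 8) (c₃ := 1) (BX := 1) (BD := 0) (BC := 1)
    (M₁ := 2 * KtowerP 1 2 2 8 (1 / 8) 1 1 0 1 * Ktw 1 2 (1 / 2 * 1) + 1)
    (C := 2 * ((3 * 2 ^ 1 : ℕ) * (1 * ((2 : ℕ) : ℝ) ^ (1 + 2))) * Ktw 1 2 (1 / 2 * 1) + 1)
    ?_ one_pos ?_ ?_ (fun i _ => two_pow_le_exp (by norm_num) i.2) one_pos zero_le_one le_rfl zero_le_one ?_ ?_
    (le_add_of_nonneg_right zero_le_one) (le_add_of_nonneg_right zero_le_one)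
    (X := fun i => diagKer (twGeo 1 i.1 (5 * (i.2 + 1)) (i.2 + 1) 2 1 5) 1
      fun z => (twGeo 1 i.1 (5 * (i.2 + 1)) (i.2 + 1) 2 1 5).len z ^ 2)
    (Xw := fun i _ => diagKer (twGeo 1 i.1 (5 * (i.2 + 1)) (i.2 + 1) 2 1 5) 1
      fun z => (twGeo 1 i.1 (5 * (i.2 + 1)) (i.2 + 1) 2 1 5).len z ^ 2)
    (Ck := fun i q => diagKer (twGeo 1 i.1 (5 * (i.2 + 1)) (i.2 + 1) 2 1 5) 1
      fun z => cubeInd (i.2 + 1) 2 q z * ((twGeo 1 i.1 (5 * (i.2 + 1)) (i.2 + 1) 2 1 5).len z ^ 2)⁻¹)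
    (fun i y y'' => diag_hX 1 2 (hrefl i) (hlen i) y y'') (fun i _ y y'' => diag_hX 1 2 (hrefl i) (hlen i) y y'')
    (fun _ _ _ _ => ?_)
    (fun i q y y' hy hy' => diag_h2148 1 2 (hrefl i) (hL1 i) one_pos (cubeInd_zero_or_one (i.2 + 1) 2)
      (fun q y h => js_spec (by norm_num) (by norm_num) (inCube_of_cubeInd_ne_zero h)) q y y' hy hy')
    (fun i q y'' y' h => diag_hCk0 1 2 q y'' y' h)
    (fun i q => diag_h270 (g := twGeo 1 i.1 (5 * (i.2 + 1)) (i.2 + 1) 2 1 5) 1 2 (hlen i) (cubeInd (i.2 + 1) 2)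
      (hfun (i.2 + 1) 2) (cubeInd_zero_or_one (i.2 + 1) 2) (cubeInd_mul_hfun (Nat.succ_pos i.2) 2) q)
    (fun i _ => diag_hinv 1 2 (hlen i))
  · -- L ≤ n
    norm_num
  · -- 0 ≤ RM
    try dsimp only
    positivity
  · -- RM ≤ nM + 1
    try dsimp only
    push_cast
    linarith
  · norm_num
  · norm_num
  · norm_num
  · positivity
  · positivity
  · -- change of domain: X̃ = X, B_D = 0
    simp

/-- **NON-VACUITY OF `prop23Printed_towerFamily` ON AN INFINITE TOWER FAMILY**: the same family of towers of every
height and every block size, with the power-4 diagonal kernels X = X̃_□ : δ_{yy″}(L^jη)^{4−d}, C_□ : δ_{yy′}□(y)(L^jη)^{−4−d}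
(B_X = B_C = 1, B_D = 0, δ₀ = 8, δ₁ = 1, σ = ⅛, c₃ = 1), Cinv := the (2.69)-kernel of K_w(X)^{−1}, M₁ := 2K₄^tow·K_TW(½) + 1,
O(1) := 2·6·2⁵·K_TW(½) + 1: every hypothesis of `prop23Printed_towerFamily` is discharged, so `B6.Prop23Printed` holds
on a family of genuinely multi-level situations by this route. [folklore] -/
theorem prop23Printed_diagonalTowerFamily :
    B6.Prop23Printed 1 (fun i : ℕ × ℕ => twGeo 1 i.1 (5 * (i.2 + 1)) (i.2 + 1) 2 1 5)
      (fun i => ⟨diagKer (twGeo 1 i.1 (5 * (i.2 + 1)) (i.2 + 1) 2 1 5) 1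
        fun z => ((twGeo 1 i.1 (5 * (i.2 + 1)) (i.2 + 1) 2 1 5).len z ^ 4)⁻¹⟩) := by
  have hlen : ∀ (i : ℕ × ℕ) (y : (twGeo 1 i.1 (5 * (i.2 + 1)) (i.2 + 1) 2 1 5).Site),
      0 < (twGeo 1 i.1 (5 * (i.2 + 1)) (i.2 + 1) 2 1 5).len y :=
    fun i y => twGeo_len_pos 1 i.1 (5 * (i.2 + 1)) (i.2 + 1) 2 1 5 (by norm_num) one_pos y
  have hrefl : ∀ (i : ℕ × ℕ) (y : (twGeo 1 i.1 (5 * (i.2 + 1)) (i.2 + 1) 2 1 5).Site),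
      (twGeo 1 i.1 (5 * (i.2 + 1)) (i.2 + 1) 2 1 5).dist y y = 0 :=
    fun i => (twGeo_hyps266 1 i.1 (5 * (i.2 + 1)) (i.2 + 1) 2 1 5).2.1
  have hL1 : ∀ i : ℕ × ℕ, 1 ≤ (twGeo 1 i.1 (5 * (i.2 + 1)) (i.2 + 1) 2 1 5).L := fun _ => by
    show (1 : ℝ) ≤ ((2 : ℕ) : ℝ)
    norm_num
  have hc : 0 ≤ Ktw 1 2 (1 / 2 * 1) := Ktw_nonneg 1 2 (by norm_num) one_pos
  have hK : 0 ≤ KtowerP 1 2 4 8 (1 / 8) 1 1 0 1 :=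
    KtowerP_nonneg 1 2 4 (by norm_num) (by norm_num) zero_le_one zero_le_one le_rfl zero_le_one
  refine prop23Printed_towerFamily 1 2 (fun i : ℕ × ℕ => i.1) (fun _ => 5) (fun i => i.2 + 1) (fun _ => 1)
    (fun _ => 5) _ (fun i => Nat.succ_pos i.2) (by norm_num) (fun _ => ?_) (fun _ => one_pos) (fun i => ?_)
    (fun i => ?_) (δ₀ := 8) (δ₁ := 1) (σ := 1 / 8) (c₃ := 1) (BX := 1) (BD := 0) (BC := 1)
    (M₁ := 2 * KtowerP 1 2 4 8 (1 / 8) 1 1 0 1 * Ktw 1 2 (1 / 2 * 1) + 1)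
    (C := 2 * ((3 * 2 ^ 1 : ℕ) * (1 * ((2 : ℕ) : ℝ) ^ (1 + 4))) * Ktw 1 2 (1 / 2 * 1) + 1)
    ?_ one_pos ?_ ?_ (fun i _ => two_pow_le_exp (by norm_num) i.2) one_pos zero_le_one le_rfl zero_le_one ?_ ?_
    (le_add_of_nonneg_right zero_le_one) (le_add_of_nonneg_right zero_le_one)
    (X := fun i => diagKer (twGeo 1 i.1 (5 * (i.2 + 1)) (i.2 + 1) 2 1 5) 1
      fun z => (twGeo 1 i.1 (5 * (i.2 + 1)) (i.2 + 1) 2 1 5).len z ^ 4)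
    (Xw := fun i _ => diagKer (twGeo 1 i.1 (5 * (i.2 + 1)) (i.2 + 1) 2 1 5) 1
      fun z => (twGeo 1 i.1 (5 * (i.2 + 1)) (i.2 + 1) 2 1 5).len z ^ 4)
    (Ck := fun i q => diagKer (twGeo 1 i.1 (5 * (i.2 + 1)) (i.2 + 1) 2 1 5) 1
      fun z => cubeInd (i.2 + 1) 2 q z * ((twGeo 1 i.1 (5 * (i.2 + 1)) (i.2 + 1) 2 1 5).len z ^ 4)⁻¹)
    (fun i y y'' => diag_hX 1 4 (hrefl i) (hlen i) y y'') (fun i _ y y'' => diag_hX 1 4 (hrefl i) (hlen i) y y'')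
    (fun _ _ _ _ => ?_)
    (fun i q y y' hy hy' => diag_h2148 1 4 (hrefl i) (hL1 i) one_pos (cubeInd_zero_or_one (i.2 + 1) 2)
      (fun q y h => js_spec (by norm_num) (by norm_num) (inCube_of_cubeInd_ne_zero h)) q y y' hy hy')
    (fun i q y'' y' h => diag_hCk0 1 4 q y'' y' h)
    (fun i q => diag_h270 (g := twGeo 1 i.1 (5 * (i.2 + 1)) (i.2 + 1) 2 1 5) 1 4 (hlen i) (cubeInd (i.2 + 1) 2)
      (hfun (i.2 + 1) 2) (cubeInd_zero_or_one (i.2 + 1) 2) (cubeInd_mul_hfun (Nat.succ_pos i.2) 2) q)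
    (fun i _ => diag_hinv 1 4 (hlen i))
  · -- L ≤ n
    norm_num
  · -- 0 ≤ RM
    try dsimp only
    positivity
  · -- RM ≤ nM + 1
    try dsimp only
    push_cast
    linarith
  · norm_num
  · norm_num
  · norm_num
  · positivity
  · positivity
  · -- change of domain: X̃ = X, B_D = 0
    simp

end Literature.MathematicalPhysics.QuantumFieldTheory.Balaban1983to89.B6TowerPrinted
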